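import Mathlib
import Summits.MatrixMultiplication.MatrixMultiplication.Theorems.HiddenToeplitzCornersHiddenCornerLemmaRStein
import Summits.MatrixMultiplication.MatrixMultiplication.Theorems.HiddenToeplitzCornersHiddenCornerLemmaRPhiInjKrylov

/-!
# Reduction of the `p = 2` G-const dual law to the three-column conjecture PHI-INJ₃
# (hidden-corner lemma, crux stmt-MatrixMultiplication-10752)

Support file for crux item `stmt-MatrixMultiplication-10752`
(`Summit.MatrixMultiplication.MatrixMultiplication.Theses.HiddenToeplitzCorners.HiddenCornerLemmaR`),
line `frobenius-dual-short-syzygies`, stub `hclR_gconstDualLaw_p_two_of_phiInj3`: the G-const dual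
law `stub_gconstDualLaw` at `p = 2` (conclusion `r ≤ 2 * p`) follows from the hypothesis PHI-INJ₃ —
"for a nonsingular three-column design of the two-generator class, the twisted evaluation maps
`Λ ↦ ∑ c, (∑ j, ((A_k *ᵥ Λᵀ c) j) • (Zᵀ)^j) *ᵥ (Eᵀ c)` (`A_k := ∑ i, G₀ i k • (Zᵀ)^i`) are jointly
surjective onto the twisted evaluations of the Krylov span of the frame".

`Z` is the lower shift on `Fin N → ℂ` written verbatim as in the crux (`Z i j = [i = j + 1]`).

Proof.  Suppose `4 ≤ r`.  By `hclR_column_absorbed` (module `…PhiInjKrylov`) some column `b` of the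
frame `E` lies in the Krylov span of three other columns `ι 0, ι 1, ι 2`.  The sub-design on these
three columns (`E.submatrix id ι`, `M * E.submatrix id ι`, `X₀ := 1`) is again nonsingular of
rank `3` (`Matrix.rank_mul_eq_right_of_isUnit_det`) and inherits the annihilator hypothesis
(extend a three-column test matrix by zero, `hclR_phi_sum_extend`).  PHI-INJ₃ then produces, for
every `μ`, a three-column test matrix `Λ` whose twisted evaluation equals that of `μ` against
column `b`; the test matrix "`Λ` on the columns `ι`, `-μ` on column `b`" is annihilated, so the
annihilator hypothesis gives `μᵀ F = 0` for every `μ`, i.e. `F = 0`, contradicting `rank F = r`.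

* `hclR_phi_T_add`, `hclR_phi_T_zero`, `hclR_phi_T_ite`, `hclR_phi_T_neg` — linearity of the
  twisted evaluation in the test column;
* `hclR_phi_sum_extend`, `hclR_phi_sum_single` — column sums of twisted evaluations of test
  matrices extended by zero / supported on one column;
* `hclR_gconstDualLaw_p_two_of_phiInj3` — the registered statement.
-/

set_option linter.dupNamespace false

namespace Summit.MatrixMultiplication.MatrixMultiplication.Theorems

open Matrix BigOperators Finset

/-- Additivity of the twisted evaluation `x ↦ (∑ j, ((A *ᵥ x) j) • (Zᵀ)^j) *ᵥ e`. -/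
theorem hclR_phi_T_add {N : ℕ} (A : Matrix (Fin N) (Fin N) ℂ) (x y e : Fin N → ℂ) :
    (∑ j : Fin N, ((A *ᵥ (x + y)) j) •
        (Matrix.of fun i j : Fin N => if (i : ℕ) = (j : ℕ) + 1 then (1 : ℂ) else 0)ᵀ ^ (j : ℕ)) *ᵥ e =
      (∑ j : Fin N, ((A *ᵥ x) j) •
        (Matrix.of fun i j : Fin N => if (i : ℕ) = (j : ℕ) + 1 then (1 : ℂ) else 0)ᵀ ^ (j : ℕ)) *ᵥ e +
      (∑ j : Fin N, ((A *ᵥ y) j) •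
        (Matrix.of fun i j : Fin N => if (i : ℕ) = (j : ℕ) + 1 then (1 : ℂ) else 0)ᵀ ^ (j : ℕ)) *ᵥ e := by
  rw [← Matrix.add_mulVec, ← Finset.sum_add_distrib]
  congr 1
  refine Finset.sum_congr rfl fun j _ => ?_
  rw [Matrix.mulVec_add, Pi.add_apply, add_smul]

/-- The twisted evaluation vanishes at `x = 0`. -/
theorem hclR_phi_T_zero {N : ℕ} (A : Matrix (Fin N) (Fin N) ℂ) (e : Fin N → ℂ) :
    (∑ j : Fin N, ((A *ᵥ (0 : Fin N → ℂ)) j) •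
        (Matrix.of fun i j : Fin N => if (i : ℕ) = (j : ℕ) + 1 then (1 : ℂ) else 0)ᵀ ^ (j : ℕ)) *ᵥ e = 0 := by
  simp

/-- The twisted evaluation commutes with `if … then x else 0`. -/
theorem hclR_phi_T_ite {N : ℕ} (P : Prop) [Decidable P] (A : Matrix (Fin N) (Fin N) ℂ)
    (x e : Fin N → ℂ) :
    (∑ j : Fin N, ((A *ᵥ (if P then x else 0)) j) •
        (Matrix.of fun i j : Fin N => if (i : ℕ) = (j : ℕ) + 1 then (1 : ℂ) else 0)ᵀ ^ (j : ℕ)) *ᵥ e =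
      if P then (∑ j : Fin N, ((A *ᵥ x) j) •
        (Matrix.of fun i j : Fin N => if (i : ℕ) = (j : ℕ) + 1 then (1 : ℂ) else 0)ᵀ ^ (j : ℕ)) *ᵥ e
      else 0 := by
  by_cases h : P
  · rw [if_pos h, if_pos h]
  · rw [if_neg h, if_neg h, hclR_phi_T_zero]

/-- The twisted evaluation at `-x`. -/
theorem hclR_phi_T_neg {N : ℕ} (A : Matrix (Fin N) (Fin N) ℂ) (x e : Fin N → ℂ) :
    (∑ j : Fin N, ((A *ᵥ (-x)) j) •
        (Matrix.of fun i j : Fin N => if (i : ℕ) = (j : ℕ) + 1 then (1 : ℂ) else 0)ᵀ ^ (j : ℕ)) *ᵥ e =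
      -((∑ j : Fin N, ((A *ᵥ x) j) •
        (Matrix.of fun i j : Fin N => if (i : ℕ) = (j : ℕ) + 1 then (1 : ℂ) else 0)ᵀ ^ (j : ℕ)) *ᵥ e) := by
  apply eq_neg_of_add_eq_zero_left
  rw [← hclR_phi_T_add, neg_add_cancel, hclR_phi_T_zero]

/-- Extension by zero along `ι : Fin 3 → Fin r`: the column sum of twisted evaluations of the
extended test matrix `Λ n c := ∑ i, [ι i = c] L n i` against the frame columns `G c` is the
three-term sum against the columns `G (ι i)`. -/
theorem hclR_phi_sum_extend {N r : ℕ} (ι : Fin 3 → Fin r) (A : Matrix (Fin N) (Fin N) ℂ)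
    (G : Fin r → Fin N → ℂ) (L : Matrix (Fin N) (Fin 3) ℂ) :
    ∑ c : Fin r, (∑ j : Fin N,
        ((A *ᵥ ((Matrix.of fun (n : Fin N) (c : Fin r) =>
            ∑ i : Fin 3, if ι i = c then L n i else 0)ᵀ c)) j) •
          (Matrix.of fun i j : Fin N => if (i : ℕ) = (j : ℕ) + 1 then (1 : ℂ) else 0)ᵀ ^ (j : ℕ)) *ᵥ
        (G c) =
      ∑ i : Fin 3, (∑ j : Fin N, ((A *ᵥ (Lᵀ i)) j) •
          (Matrix.of fun i j : Fin N => if (i : ℕ) = (j : ℕ) + 1 then (1 : ℂ) else 0)ᵀ ^ (j : ℕ)) *ᵥ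
        (G (ι i)) := by
  have hcol : ∀ c : Fin r, (Matrix.of fun (n : Fin N) (c : Fin r) =>
      ∑ i : Fin 3, if ι i = c then L n i else 0)ᵀ c =
      (if ι 0 = c then Lᵀ 0 else 0) + (if ι 1 = c then Lᵀ 1 else 0) + (if ι 2 = c then Lᵀ 2 else 0) := by
    intro c
    funext m
    simp only [Matrix.transpose_apply, Matrix.of_apply, Fin.sum_univ_three, Pi.add_apply, ite_apply,
      Pi.zero_apply]
  simp_rw [hcol, hclR_phi_T_add, hclR_phi_T_ite, Finset.sum_add_distrib, Finset.sum_ite_eq,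
    Finset.mem_univ, if_true, Fin.sum_univ_three]

/-- A single test column: the column sum of twisted evaluations of the test matrix supported on
column `b` with value `y` is the evaluation of `y` against `G b`. -/
theorem hclR_phi_sum_single {N r : ℕ} (b : Fin r) (A : Matrix (Fin N) (Fin N) ℂ)
    (G : Fin r → Fin N → ℂ) (y : Fin N → ℂ) :
    ∑ c : Fin r, (∑ j : Fin N,
        ((A *ᵥ ((Matrix.of fun (n : Fin N) (c : Fin r) => if c = b then y n else 0)ᵀ c)) j) •
          (Matrix.of fun i j : Fin N => if (i : ℕ) = (j : ℕ) + 1 then (1 : ℂ) else 0)ᵀ ^ (j : ℕ)) *ᵥ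
        (G c) =
      (∑ j : Fin N, ((A *ᵥ y) j) •
          (Matrix.of fun i j : Fin N => if (i : ℕ) = (j : ℕ) + 1 then (1 : ℂ) else 0)ᵀ ^ (j : ℕ)) *ᵥ
        (G b) := by
  have hcol : ∀ c : Fin r, (Matrix.of fun (n : Fin N) (c : Fin r) => if c = b then y n else 0)ᵀ c =
      if c = b then y else 0 := by
    intro c
    funext m
    simp only [Matrix.transpose_apply, Matrix.of_apply, ite_apply, Pi.zero_apply]
  simp_rw [hcol, hclR_phi_T_ite, Finset.sum_ite_eq', Finset.mem_univ, if_true]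

-- the registered binders `H`, `X₀`, `hF` etc. are named inside the `∀`
set_option linter.unusedVariables false in
/-- **Stub `hclR_gconstDualLaw_p_two_of_phiInj3`.**  PHI-INJ₃ implies the G-const dual law at
`p = 2`: with constant generators `G₀ : N × 2`, a frame `E` and a target frame `F` of rank `r`
killed by the annihilator of the design, and an invertible `M` of the class (`M - Z M Zᵀ = G₀ Hᵀ`)
with `M E = F X₀`, one has `r ≤ 2 · 2` (in fact the proof gives `r ≤ 3`). -/
theorem hclR_gconstDualLaw_p_two_of_phiInj3 :
    (∀ (N : ℕ) (G₀ : Matrix (Fin N) (Fin 2) ℂ) (E F : Matrix (Fin N) (Fin 3) ℂ) (M : Matrix (Fin N)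
    (Fin N) ℂ) (H : Matrix (Fin N) (Fin 2) ℂ) (X₀ : Matrix (Fin 3) (Fin 3) ℂ), E.rank = 3 → F.rank =
    3 → (∀ Λ : Matrix (Fin N) (Fin 3) ℂ, (∀ k : Fin 2, (∑ c : Fin 3, (∑ j : Fin N, (((∑ i : Fin N,
    G₀ i k • (Matrix.of fun i j : Fin N => if (i : ℕ) = (j : ℕ) + 1 then (1 : ℂ) else 0)ᵀ ^ (i : ℕ))
    *ᵥ (Λᵀ c)) j) • (Matrix.of fun i j : Fin N => if (i : ℕ) = (j : ℕ) + 1 then (1 : ℂ) else 0)ᵀ ^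
    (j : ℕ)) *ᵥ (Eᵀ c)) = 0) → Λᵀ * F = 0) → M - (Matrix.of fun i j : Fin N => if (i : ℕ) = (j : ℕ)
    + 1 then (1 : ℂ) else 0) * M * (Matrix.of fun i j : Fin N => if (i : ℕ) = (j : ℕ) + 1 then (1 :
    ℂ) else 0)ᵀ = G₀ * Hᵀ → M * E = F * X₀ → M.det ≠ 0 → ∀ v : Fin N → ℂ, v ∈ Submodule.span ℂ {w :
    Fin N → ℂ | ∃ (c : Fin 3) (j : ℕ), w = ((Matrix.of fun i j : Fin N => if (i : ℕ) = (j : ℕ) + 1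
    then (1 : ℂ) else 0)ᵀ ^ j) *ᵥ (Eᵀ c)} → ∀ μ : Fin N → ℂ, ∃ Λ : Matrix (Fin N) (Fin 3) ℂ, ∀ k :
    Fin 2, (∑ c : Fin 3, (∑ j : Fin N, (((∑ i : Fin N, G₀ i k • (Matrix.of fun i j : Fin N => if (i
    : ℕ) = (j : ℕ) + 1 then (1 : ℂ) else 0)ᵀ ^ (i : ℕ)) *ᵥ (Λᵀ c)) j) • (Matrix.of fun i j : Fin N
    => if (i : ℕ) = (j : ℕ) + 1 then (1 : ℂ) else 0)ᵀ ^ (j : ℕ)) *ᵥ (Eᵀ c)) = (∑ j : Fin N, (((∑ i :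
    Fin N, G₀ i k • (Matrix.of fun i j : Fin N => if (i : ℕ) = (j : ℕ) + 1 then (1 : ℂ) else 0)ᵀ ^
    (i : ℕ)) *ᵥ μ) j) • (Matrix.of fun i j : Fin N => if (i : ℕ) = (j : ℕ) + 1 then (1 : ℂ) else 0)ᵀ
    ^ (j : ℕ)) *ᵥ v) → ∀ (r N p : ℕ) (G₀ : Matrix (Fin N) (Fin p) ℂ) (E F : Matrix (Fin N) (Fin r)
    ℂ) (M : Matrix (Fin N) (Fin N) ℂ) (H : Matrix (Fin N) (Fin p) ℂ) (X₀ : Matrix (Fin r) (Fin r)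
    ℂ), p = 2 → E.rank = r → F.rank = r → (∀ Λ : Matrix (Fin N) (Fin r) ℂ, (∀ k : Fin p, (∑ c : Fin
    r, (∑ j : Fin N, (((∑ i : Fin N, G₀ i k • (Matrix.of fun i j : Fin N => if (i : ℕ) = (j : ℕ) + 1
    then (1 : ℂ) else 0)ᵀ ^ (i : ℕ)) *ᵥ (Λᵀ c)) j) • (Matrix.of fun i j : Fin N => if (i : ℕ) = (j :
    ℕ) + 1 then (1 : ℂ) else 0)ᵀ ^ (j : ℕ)) *ᵥ (Eᵀ c)) = 0) → Λᵀ * F = 0) → M - (Matrix.of fun i j :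
    Fin N => if (i : ℕ) = (j : ℕ) + 1 then (1 : ℂ) else 0) * M * (Matrix.of fun i j : Fin N => if (i
    : ℕ) = (j : ℕ) + 1 then (1 : ℂ) else 0)ᵀ = G₀ * Hᵀ → M * E = F * X₀ → M.det ≠ 0 → r ≤ 2 * p := by
  intro hPHI r N p G₀ E F M H X₀ hp hE hF hann hM hME hdet
  subst hp
  by_contra hr4
  have hr : 4 ≤ r := by omega
  obtain ⟨b, ι, hι, hιb, hb⟩ := hclR_column_absorbed N r E hr
  -- (i) the three columns `ι` form a rank-3 frame
  have hcols : LinearIndependent ℂ E.col := by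
    rw [linearIndependent_iff_card_eq_finrank_span, Fintype.card_fin, Set.finrank,
      ← Matrix.rank_eq_finrank_span_cols, hE]
  have hE3 : (E.submatrix id ι).rank = 3 := by
    have h3 : LinearIndependent ℂ (E.submatrix id ι).col := hcols.comp ι hι
    have h := linearIndependent_iff_card_eq_finrank_span.mp h3
    rw [Fintype.card_fin, Set.finrank, ← Matrix.rank_eq_finrank_span_cols] at h
    exact h.symm
  -- (ii) so does its image under the invertible `M`
  have hF3 : (M * E.submatrix id ι).rank = 3 := by
    rw [Matrix.rank_mul_eq_right_of_isUnit_det M _ (isUnit_iff_ne_zero.mpr hdet), hE3]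
  -- `M` maps the sub-frame into the span of `F`
  have hF3X : M * E.submatrix id ι = F * X₀.submatrix id ι := by
    ext n i
    have h := congrFun (congrFun hME n) (ι i)
    simpa only [Matrix.mul_apply, Matrix.submatrix_apply, id] using h
  -- (iii) the annihilator hypothesis descends to the sub-design (extend test matrices by zero)
  have hann3 : ∀ Λ : Matrix (Fin N) (Fin 3) ℂ, (∀ k : Fin 2, (∑ c : Fin 3, (∑ j : Fin N,
      (((∑ i : Fin N, G₀ i k •
          (Matrix.of fun i j : Fin N => if (i : ℕ) = (j : ℕ) + 1 then (1 : ℂ) else 0)ᵀ ^ (i : ℕ)) *ᵥ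
        (Λᵀ c)) j) •
        (Matrix.of fun i j : Fin N => if (i : ℕ) = (j : ℕ) + 1 then (1 : ℂ) else 0)ᵀ ^ (j : ℕ)) *ᵥ
      ((E.submatrix id ι)ᵀ c)) = 0) → Λᵀ * (M * E.submatrix id ι) = 0 := by
    intro Λ hΛ
    have hΛF : (Matrix.of fun (n : Fin N) (c : Fin r) => ∑ i : Fin 3, if ι i = c then Λ n i else 0)ᵀ *
        F = 0 := by
      apply hann
      intro k
      rw [hclR_phi_sum_extend]
      exact hΛ k
    have hΛF' : Λᵀ * F = 0 := by
      ext i a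
      have h := congrFun (congrFun hΛF (ι i)) a
      simpa [Matrix.mul_apply, hι.eq_iff] using h
    rw [hF3X, ← Matrix.mul_assoc, hΛF', Matrix.zero_mul]
  -- the absorbed column lies in the Krylov span of the sub-frame
  have hb3 : (Eᵀ b) ∈ Submodule.span ℂ {w : Fin N → ℂ | ∃ (c : Fin 3) (j : ℕ),
      w = ((Matrix.of fun i j : Fin N => if (i : ℕ) = (j : ℕ) + 1 then (1 : ℂ) else 0)ᵀ ^ j) *ᵥ
        ((E.submatrix id ι)ᵀ c)} := hb
  have key := hPHI N G₀ (E.submatrix id ι) (M * E.submatrix id ι) M H 1 hE3 hF3 hann3 hM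
    (Matrix.mul_one _).symm hdet (Eᵀ b) hb3
  -- (iv) every row functional kills `F`, so `F = 0`
  have hF0 : F = 0 := by
    ext n₀ a
    obtain ⟨Λ, hΛ⟩ := key (Pi.single n₀ 1)
    have hΛF : ((Matrix.of fun (n : Fin N) (c : Fin r) => ∑ i : Fin 3, if ι i = c then Λ n i else 0) +
        (Matrix.of fun (n : Fin N) (c : Fin r) =>
          if c = b then (-(Pi.single n₀ 1 : Fin N → ℂ)) n else 0))ᵀ * F = 0 := by
      apply hann
      intro k
      have hsplit : ∀ (P Q : Matrix (Fin N) (Fin r) ℂ) (c : Fin r), (P + Q)ᵀ c = Pᵀ c + Qᵀ c :=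
        fun P Q c => rfl
      simp only [hsplit, hclR_phi_T_add, Finset.sum_add_distrib]
      rw [hclR_phi_sum_extend, hclR_phi_sum_single, hclR_phi_T_neg, ← sub_eq_add_neg, sub_eq_zero]
      exact hΛ k
    have h := congrFun (congrFun hΛF b) a
    simpa [Matrix.mul_apply, hιb, Pi.single_apply] using h
  have h0 : F.rank = 0 := by rw [hF0, Matrix.rank_zero]
  omega

end Summit.MatrixMultiplication.MatrixMultiplication.Theorems
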